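import Summits.KontsevichZagierPeriods.KontsevichZagierPeriods.Theorems.RootDecompRationalCubeDichotomyArctanFibreP1

/-!
# Arctan-fibre calculus for `RationalCubePiKernelSingle` (route `RootDecompRationalCubeDichotomy`, crux stmt-KontsevichZagierPeriods-26322) at `m = 2` · part 2/9

Cell `decomp-kz`, lens 2 (decomp-kz-lens-2 g7): the GENERIC (arctan-fibre) side of the first open rung `m = 2` of
`RationalCubePiKernelSingle` decided INSIDE the Kontsevich–Zagier calculus with `N = 0`, by rules 1+2 only: fibred Möbius
charts `x ↦ x(q+r)/(q+rx)` (`MoebiusData.rel`), the TANGENT-ADDITION chart `x ↦ x(1−p)/(1−px²)` = the group law of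
`tan` as a move (`TanData.tan_add`), Serret's base involution `y ↦ (1−y)/(1+y)` (`rel_serret`), one moving-centre
dissection with null surgery (§8), odd-symmetry vanishing (§7b).  Decided census classes: `π·log 2` (`pilog2_rel`,
census pair #33), Catalan (`catalan_rel`, #32), dilogarithm classes `dilogA_rel` (#28), `dilogB_rel` (#30),
`dilogC_rel` (#24), seven moment relations; §9 the LITERAL binder instances of `RationalCubePiKernelSingle` at
`m = 2`, `N = 0` (the route decl is not referenced by name, so these modules do not import the route file);
§10 six UNIFORM CLASSES `single_classSwap/Reflect/Halve/Moebius/Serret/TanAdd`.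

Source: `HOME/decomp-kz-lens-2/g7/ArctanFibreCalculus.lean` sha256 964497cf335d1c59 (2144 l; critic decomp-kz-crit-1 g2
CLEARED 2026-08-30T09:13:02Z incl. transcription numerics, std axioms), split into 9 modules by the landing seat
decomp-kz-census-1 g7 (contexts re-opened per part; generic docstrings added where the source had none).
No `sorry`; standard axioms.  References: [cite: KontsevichZagier2001, §1.2]; J.-A. Serret (1844).
-/

noncomputable section

open Set MeasureTheory MvPolynomial
open Literature.ModelTheory.ExponentialFields (IsSemialgebraic)
open Literature.NumberTheory.Transcendental
open Literature.NumberTheory.Transcendental.KZ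
open Literature.NumberTheory.Transcendental.KZ.RFun
open Summit.KontsevichZagierPeriods.KontsevichZagierPeriods.Theorems

namespace Summit.KontsevichZagierPeriods.RootDecompRationalCubeDichotomy.ArctanFibre

-- PRIVATE copy (landed twin elsewhere / dedup.landed): cube_succ_eq_band, rel_fibreMap, mem_cube_two, init_mem_cube_one, mem_cube_one_iff, snoc_two_zero, snoc_two_one, init_apply_zero, aeval_snoc_rename, aeval_lift_num, aeval_lift_den
/-- `[0,1]^{M+1}` is the band over `[0,1]^M` with edges `0` and `1`. -/
private theorem cube_succ_eq_band (M : ℕ) :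
    KZ.cube (M + 1) = KZlog.band (KZ.cube M) (fun _ => (0 : ℝ)) (fun _ => 1) := by
  rw [KZ.cube_succ_eq]; rfl

/-- **Fibred substitution for regular rational functions** (the landed move
`KZ.of_sub_of_mem_relations_of_fibreMap` on the closed cube, tameness discharged). -/
private theorem rel_fibreMap {M : ℕ} (T S U : RFun (M + 1)) (ψs : (Fin (M + 1) → ℝ) → ℝ)
    (hderiv : ∀ z ∈ KZ.cube (M + 1),
      HasDerivAt (fun s : ℝ => U.fn (Fin.snoc (Fin.init z) s)) (ψs z) (z (Fin.last M)))
    (hpos : ∀ z ∈ KZ.cube (M + 1), 0 < ψs z)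
    (h0 : ∀ x ∈ KZ.cube M, U.fn (Fin.snoc x 0) = 0)
    (h1 : ∀ x ∈ KZ.cube M, U.fn (Fin.snoc x 1) = 1)
    (hint : ∀ z ∈ KZ.cube (M + 1), T.fn z = S.fn (Fin.snoc (Fin.init z) (U.fn z)) * ψs z) :
    KZ.of T.rep - KZ.of S.rep ∈ KZ.relations :=
  KZ.of_sub_of_mem_relations_of_fibreMap (G := KZ.cube M) (a := fun _ => (0 : ℝ))
    (b := fun _ => (1 : ℝ)) (a' := fun _ => (0 : ℝ)) (b' := fun _ => (1 : ℝ)) U.fn ψs T.rep S.rep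
    (cube_succ_eq_band M) (cube_succ_eq_band M) (fun _ _ => zero_le_one)
    U.isSemialgebraicFunOn_fn (fun z hz => (U.analyticOnNhd_fn z hz).differentiableAt)
    hderiv hpos h0 h1 hint

/-- `mem_cube_two`: auxiliary theorem of the arctan-fibre calculus for `RationalCubePiKernelSingle` (stmt-26322) — see the module docstring; verbatim from the lens file. -/
private theorem mem_cube_two {z : Fin 2 → ℝ} (hz : z ∈ KZ.cube 2) :
    (0 ≤ z 0 ∧ z 0 ≤ 1) ∧ (0 ≤ z 1 ∧ z 1 ≤ 1) := ⟨hz 0, hz 1⟩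

/-- `init_mem_cube_one`: auxiliary theorem of the arctan-fibre calculus for `RationalCubePiKernelSingle` (stmt-26322) — see the module docstring; verbatim from the lens file. -/
private theorem init_mem_cube_one {z : Fin 2 → ℝ} (hz : z ∈ KZ.cube 2) : Fin.init z ∈ KZ.cube 1 :=
  fun i => hz (Fin.castSucc i)

/-- `mem_cube_one_iff`: auxiliary theorem of the arctan-fibre calculus for `RationalCubePiKernelSingle` (stmt-26322) — see the module docstring; verbatim from the lens file. -/
private theorem mem_cube_one_iff {y : Fin 1 → ℝ} : y ∈ KZ.cube 1 ↔ 0 ≤ y 0 ∧ y 0 ≤ 1 := by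
  rw [KZ.mem_cube]
  exact ⟨fun h => h 0, fun h i => by fin_cases i; exact h⟩

/-- `snoc_two_zero`: auxiliary theorem of the arctan-fibre calculus for `RationalCubePiKernelSingle` (stmt-26322) — see the module docstring; verbatim from the lens file. -/
@[simp] private theorem snoc_two_zero (y : Fin 1 → ℝ) (s : ℝ) : (Fin.snoc y s : Fin 2 → ℝ) 0 = y 0 := rfl

/-- `snoc_two_one`: auxiliary theorem of the arctan-fibre calculus for `RationalCubePiKernelSingle` (stmt-26322) — see the module docstring; verbatim from the lens file. -/
@[simp] private theorem snoc_two_one (y : Fin 1 → ℝ) (s : ℝ) : (Fin.snoc y s : Fin 2 → ℝ) 1 = s := rfl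

/-- `init_apply_zero`: auxiliary theorem of the arctan-fibre calculus for `RationalCubePiKernelSingle` (stmt-26322) — see the module docstring; verbatim from the lens file. -/
@[simp] private theorem init_apply_zero (z : Fin 2 → ℝ) : Fin.init z 0 = z 0 := rfl

/-- `aeval` at a `snoc` point of a polynomial in the first variables. -/
private theorem aeval_snoc_rename {M : ℕ} (P : MvPolynomial (Fin M) ℚ) (x : Fin M → ℝ) (s : ℝ) :
    aeval (Fin.snoc x s : Fin (M + 1) → ℝ) (MvPolynomial.rename Fin.castSucc P) = aeval x P := by
  have h : ((Fin.snoc x s : Fin (M + 1) → ℝ) ∘ Fin.castSucc) = x := by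
    funext i
    simp [Function.comp]
  rw [aeval_rename, h]

/-- `aeval_lift_num`: auxiliary theorem of the arctan-fibre calculus for `RationalCubePiKernelSingle` (stmt-26322) — see the module docstring; verbatim from the lens file. -/
private theorem aeval_lift_num (E : RFun 1) (z : Fin 2 → ℝ) :
    aeval z E.lift.num = aeval (Fin.init z) E.num := by
  show aeval z (MvPolynomial.rename Fin.castSucc E.num) = _
  rw [aeval_rename]; rfl

/-- `aeval_lift_den`: auxiliary theorem of the arctan-fibre calculus for `RationalCubePiKernelSingle` (stmt-26322) — see the module docstring; verbatim from the lens file. -/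
private theorem aeval_lift_den (E : RFun 1) (z : Fin 2 → ℝ) :
    aeval z E.lift.den = aeval (Fin.init z) E.den := by
  show aeval z (MvPolynomial.rename Fin.castSucc E.den) = _
  rw [aeval_rename]; rfl

namespace MoebiusData

variable (μ : MoebiusData)

/-- `q(y)`, `r(y)` as real functions. -/
def q (t : ℝ) : ℝ := pv μ.Q t
/-- `r(y)`. -/
def r (t : ℝ) : ℝ := pv μ.R t

/-- **The Möbius chart** `U(y, x) = x (q + r)/(q + r x)`. -/
def chart : RFun 2 :=
  ⟨X 1 * MvPolynomial.rename Fin.castSucc (μ.Q + μ.R),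
    MvPolynomial.rename Fin.castSucc μ.Q + MvPolynomial.rename Fin.castSucc μ.R * X 1, fun z hz => by
      have h01 := mem_cube_two hz
      simp only [map_add, map_mul, aeval_X, aeval_rename_two]
      exact (convex_pos (μ.hQ _ h01.1) (μ.hQR _ h01.1) h01.2.1 h01.2.2).ne'⟩

/-- `chart_fn_snoc`: auxiliary theorem of the arctan-fibre calculus for `RationalCubePiKernelSingle` (stmt-26322) — see the module docstring; verbatim from the lens file. -/
theorem chart_fn_snoc (y : Fin 1 → ℝ) (s : ℝ) :
    μ.chart.fn (Fin.snoc y s) = s * (μ.q (y 0) + μ.r (y 0)) / (μ.q (y 0) + μ.r (y 0) * s) := by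
  rw [fn_apply]
  simp only [chart, q, r, map_add, map_mul, aeval_X, aeval_snoc_rename, aeval_eq_pv, snoc_two_one]

/-- `chart_fn`: auxiliary theorem of the arctan-fibre calculus for `RationalCubePiKernelSingle` (stmt-26322) — see the module docstring; verbatim from the lens file. -/
theorem chart_fn (z : Fin 2 → ℝ) :
    μ.chart.fn z = z 1 * (μ.q (z 0) + μ.r (z 0)) / (μ.q (z 0) + μ.r (z 0) * z 1) := by
  have h := μ.chart_fn_snoc (Fin.init z) (z (Fin.last 1))
  rw [Fin.snoc_init_self] at h
  exact h

/-- The fibre derivative `(q + r) q/(q + r x)²` of the Möbius chart. -/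
def deriv (z : Fin 2 → ℝ) : ℝ :=
  (μ.q (z 0) + μ.r (z 0)) * μ.q (z 0) / (μ.q (z 0) + μ.r (z 0) * z 1) ^ 2

/-- `facts`: auxiliary theorem of the arctan-fibre calculus for `RationalCubePiKernelSingle` (stmt-26322) — see the module docstring; verbatim from the lens file. -/
theorem facts {z : Fin 2 → ℝ} (hz : z ∈ KZ.cube 2) :
    0 < μ.q (z 0) ∧ 0 < μ.q (z 0) + μ.r (z 0) ∧ 0 < μ.q (z 0) + μ.r (z 0) * z 1 ∧
      0 ≤ z 1 ∧ z 1 ≤ 1 := by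
  have h01 := mem_cube_two hz
  exact ⟨μ.hQ _ h01.1, μ.hQR _ h01.1, convex_pos (μ.hQ _ h01.1) (μ.hQR _ h01.1) h01.2.1 h01.2.2,
    h01.2.1, h01.2.2⟩

/-- `deriv_pos`: auxiliary theorem of the arctan-fibre calculus for `RationalCubePiKernelSingle` (stmt-26322) — see the module docstring; verbatim from the lens file. -/
theorem deriv_pos {z : Fin 2 → ℝ} (hz : z ∈ KZ.cube 2) : 0 < μ.deriv z := by
  obtain ⟨hq, hqr, hd, -, -⟩ := μ.facts hz
  exact div_pos (mul_pos hqr hq) (pow_pos hd 2)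

/-- `chart_mem`: auxiliary theorem of the arctan-fibre calculus for `RationalCubePiKernelSingle` (stmt-26322) — see the module docstring; verbatim from the lens file. -/
theorem chart_mem {z : Fin 2 → ℝ} (hz : z ∈ KZ.cube 2) : 0 ≤ μ.chart.fn z ∧ μ.chart.fn z ≤ 1 := by
  obtain ⟨hq, hqr, hd, hx0, hx1⟩ := μ.facts hz
  rw [chart_fn]
  refine ⟨div_nonneg (mul_nonneg hx0 hqr.le) hd.le, (div_le_one hd).mpr ?_⟩
  nlinarith

/-- `chart_hasDerivAt`: auxiliary theorem of the arctan-fibre calculus for `RationalCubePiKernelSingle` (stmt-26322) — see the module docstring; verbatim from the lens file. -/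
theorem chart_hasDerivAt {z : Fin 2 → ℝ} (hz : z ∈ KZ.cube 2) :
    HasDerivAt (fun s : ℝ => μ.chart.fn (Fin.snoc (Fin.init z) s)) (μ.deriv z) (z 1) := by
  obtain ⟨hq, hqr, hd, -, -⟩ := μ.facts hz
  have hfun : (fun s : ℝ => μ.chart.fn (Fin.snoc (Fin.init z) s)) = fun s =>
      s * (μ.q (z 0) + μ.r (z 0)) / (μ.q (z 0) + μ.r (z 0) * s) := by
    funext s
    rw [chart_fn_snoc, init_apply_zero]
  rw [hfun]
  have h := ((hasDerivAt_id (z 1)).mul_const (μ.q (z 0) + μ.r (z 0))).div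
    (((hasDerivAt_id (z 1)).const_mul (μ.r (z 0))).const_add (μ.q (z 0))) hd.ne'
  refine h.congr_deriv ?_
  unfold deriv
  simp only [id, one_mul, mul_one]
  rw [div_eq_div_iff (pow_ne_zero 2 hd.ne') (pow_ne_zero 2 hd.ne')]
  ring

/-- **Möbius move**: if `T(y,x) = S(y, U(y,x)) · ∂ₓU(y,x)` on the square for the Möbius chart
`U = x(q+r)/(q+rx)`, then `[T] ≡ [S]`. -/
theorem rel (T S : RFun 2)
    (hint : ∀ z ∈ KZ.cube 2, T.fn z =
      S.fn ![z 0, z 1 * (μ.q (z 0) + μ.r (z 0)) / (μ.q (z 0) + μ.r (z 0) * z 1)] *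
        ((μ.q (z 0) + μ.r (z 0)) * μ.q (z 0) / (μ.q (z 0) + μ.r (z 0) * z 1) ^ 2)) :
    KZ.of T.rep - KZ.of S.rep ∈ KZ.relations := by
  refine rel_fibreMap T S μ.chart μ.deriv (fun z hz => μ.chart_hasDerivAt hz)
    (fun z hz => μ.deriv_pos hz) (fun x hx => ?_) (fun x hx => ?_) (fun z hz => ?_)
  · rw [chart_fn_snoc]; simp
  · have h := mem_cube_one_iff.mp hx
    rw [chart_fn_snoc, one_mul, mul_one]
    exact div_self (μ.hQR _ h).ne'
  · rw [hint z hz, snoc_init_eq, chart_fn]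
    rfl

end MoebiusData

/-! ## 3. The tangent-addition chart `x ↦ x(1−p)/(1−px²)` -/

/-- The pure algebra of tangent addition: with `p = a₁a₂`, `U = x(1−p)/(1−px²)`,
`w a₁/(1+a₁²x²) + w a₂/(1+a₂²x²) = w (a₁+a₂)(1−p)/((1−p)² + (a₁+a₂)²U²) · (1−p)(1+px²)/(1−px²)²`. -/
theorem tan_identity (a₁ a₂ w x : ℝ) (hp1 : a₁ * a₂ < 1) (hp2 : -1 < a₁ * a₂) (hx0 : 0 ≤ x)
    (hx1 : x ≤ 1) :
    w * a₁ / (1 + (a₁ * x) ^ 2) + w * a₂ / (1 + (a₂ * x) ^ 2) =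
      w * (a₁ + a₂) * (1 - a₁ * a₂) /
          ((1 - a₁ * a₂) ^ 2 +
            ((a₁ + a₂) * (x * (1 - a₁ * a₂) / (1 - a₁ * a₂ * x ^ 2))) ^ 2) *
        ((1 - a₁ * a₂) * (1 + a₁ * a₂ * x ^ 2) / (1 - a₁ * a₂ * x ^ 2) ^ 2) := by
  have hxx : x ^ 2 ≤ 1 := by nlinarith
  have hD : 1 - a₁ * a₂ * x ^ 2 ≠ 0 := by nlinarith
  have h1 : (1 + (a₁ * x) ^ 2) ≠ 0 := by positivity
  have h2 : (1 + (a₂ * x) ^ 2) ≠ 0 := by positivity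
  have hE : (1 - a₁ * a₂) ^ 2 * (1 - a₁ * a₂ * x ^ 2) ^ 2 + ((a₁ + a₂) * (x * (1 - a₁ * a₂))) ^ 2 ≠ 0 := by
    have hq : 0 < 1 - a₁ * a₂ := by linarith
    have hD' : 0 < 1 - a₁ * a₂ * x ^ 2 := by nlinarith
    have : 0 < (1 - a₁ * a₂) ^ 2 * (1 - a₁ * a₂ * x ^ 2) ^ 2 := by positivity
    positivity
  rw [div_add_div _ _ h1 h2]
  have hU : (1 - a₁ * a₂) ^ 2 + ((a₁ + a₂) * (x * (1 - a₁ * a₂) / (1 - a₁ * a₂ * x ^ 2))) ^ 2 =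
      ((1 - a₁ * a₂) ^ 2 * (1 - a₁ * a₂ * x ^ 2) ^ 2 + ((a₁ + a₂) * (x * (1 - a₁ * a₂))) ^ 2) /
        (1 - a₁ * a₂ * x ^ 2) ^ 2 := by
    field_simp
  rw [hU, div_div_eq_mul_div, div_mul_div_comm, div_eq_div_iff (mul_ne_zero h1 h2)
    (mul_ne_zero hE (pow_ne_zero 2 hD))]
  ring

/-- Slope data of a tangent-addition chart: `a₁, a₂ : RFun 1` with `|a₁ a₂| < 1` on `[0,1]`. -/
structure TanData where
  /-- first slope -/
  A₁ : RFun 1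
  /-- second slope -/
  A₂ : RFun 1
  /-- `|a₁ a₂| < 1` -/
  hp : ∀ t ∈ Icc (0 : ℝ) 1, ev A₁ t * ev A₂ t < 1 ∧ -1 < ev A₁ t * ev A₂ t

namespace TanData

variable (τ : TanData)

/-- the slopes as real functions -/
def a₁ (t : ℝ) : ℝ := ev τ.A₁ t
/-- second slope -/
def a₂ (t : ℝ) : ℝ := ev τ.A₂ t

/-- `facts`: auxiliary theorem of the arctan-fibre calculus for `RationalCubePiKernelSingle` (stmt-26322) — see the module docstring; verbatim from the lens file. -/
theorem facts {z : Fin 2 → ℝ} (hz : z ∈ KZ.cube 2) :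
    aeval (Fin.init z) τ.A₁.den ≠ 0 ∧ aeval (Fin.init z) τ.A₂.den ≠ 0 ∧
      τ.a₁ (z 0) * τ.a₂ (z 0) < 1 ∧ -1 < τ.a₁ (z 0) * τ.a₂ (z 0) ∧ 0 ≤ z 1 ∧ z 1 ≤ 1 ∧
      0 < 1 - τ.a₁ (z 0) * τ.a₂ (z 0) * z 1 ^ 2 := by
  have h01 := mem_cube_two hz
  have hy := init_mem_cube_one hz
  have hp' := τ.hp _ h01.1
  refine ⟨τ.A₁.den_ne _ hy, τ.A₂.den_ne _ hy, hp'.1, hp'.2, h01.2.1, h01.2.2, ?_⟩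
  have hxx : z 1 ^ 2 ≤ 1 := by nlinarith
  unfold a₁ a₂
  nlinarith

/-- **The tangent-addition chart** `U(y,x) = x(1−p)/(1−px²)`, `p = a₁(y)a₂(y)` (denominators of
`a₁, a₂` cleared). -/
def chart : RFun 2 :=
  ⟨X 1 * (τ.A₁.lift.den * τ.A₂.lift.den - τ.A₁.lift.num * τ.A₂.lift.num),
    τ.A₁.lift.den * τ.A₂.lift.den - τ.A₁.lift.num * τ.A₂.lift.num * X 1 ^ 2, fun z hz => by
      obtain ⟨hD₁, hD₂, -, -, -, -, hD⟩ := τ.facts hz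
      simp only [map_sub, map_mul, map_pow, aeval_X, aeval_lift_num, aeval_lift_den]
      rw [num_eq_ev_mul_den τ.A₁ (init_mem_cube_one hz), num_eq_ev_mul_den τ.A₂ (init_mem_cube_one hz),
        init_apply_zero]
      have : aeval (Fin.init z) τ.A₁.den * aeval (Fin.init z) τ.A₂.den -
          ev τ.A₁ (z 0) * aeval (Fin.init z) τ.A₁.den * (ev τ.A₂ (z 0) * aeval (Fin.init z) τ.A₂.den) *
            z 1 ^ 2 =
          (aeval (Fin.init z) τ.A₁.den * aeval (Fin.init z) τ.A₂.den) *
            (1 - τ.a₁ (z 0) * τ.a₂ (z 0) * z 1 ^ 2) := by unfold a₁ a₂; ring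
      rw [this]
      exact mul_ne_zero (mul_ne_zero hD₁ hD₂) hD.ne'⟩

/-- `chart_fn_snoc`: auxiliary theorem of the arctan-fibre calculus for `RationalCubePiKernelSingle` (stmt-26322) — see the module docstring; verbatim from the lens file. -/
theorem chart_fn_snoc {y : Fin 1 → ℝ} (hy : y ∈ KZ.cube 1) (s : ℝ) :
    τ.chart.fn (Fin.snoc y s) =
      s * (1 - τ.a₁ (y 0) * τ.a₂ (y 0)) / (1 - τ.a₁ (y 0) * τ.a₂ (y 0) * s ^ 2) := by
  have hD₁ := τ.A₁.den_ne y hy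
  have hD₂ := τ.A₂.den_ne y hy
  rw [fn_apply]
  simp only [chart, map_sub, map_mul, map_pow, aeval_X, aeval_lift_num, aeval_lift_den, Fin.init_snoc,
    snoc_two_one]
  rw [num_eq_ev_mul_den τ.A₁ hy, num_eq_ev_mul_den τ.A₂ hy]
  have e1 : s * (aeval y τ.A₁.den * aeval y τ.A₂.den -
      ev τ.A₁ (y 0) * aeval y τ.A₁.den * (ev τ.A₂ (y 0) * aeval y τ.A₂.den)) =
      (aeval y τ.A₁.den * aeval y τ.A₂.den) * (s * (1 - τ.a₁ (y 0) * τ.a₂ (y 0))) := by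
    unfold a₁ a₂; ring
  have e2 : aeval y τ.A₁.den * aeval y τ.A₂.den -
      ev τ.A₁ (y 0) * aeval y τ.A₁.den * (ev τ.A₂ (y 0) * aeval y τ.A₂.den) * s ^ 2 =
      (aeval y τ.A₁.den * aeval y τ.A₂.den) * (1 - τ.a₁ (y 0) * τ.a₂ (y 0) * s ^ 2) := by
    unfold a₁ a₂; ring
  rw [e1, e2, mul_div_mul_left _ _ (mul_ne_zero hD₁ hD₂)]

/-- `chart_fn`: auxiliary theorem of the arctan-fibre calculus for `RationalCubePiKernelSingle` (stmt-26322) — see the module docstring; verbatim from the lens file. -/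
theorem chart_fn {z : Fin 2 → ℝ} (hz : z ∈ KZ.cube 2) :
    τ.chart.fn z = z 1 * (1 - τ.a₁ (z 0) * τ.a₂ (z 0)) / (1 - τ.a₁ (z 0) * τ.a₂ (z 0) * z 1 ^ 2) := by
  have h := τ.chart_fn_snoc (init_mem_cube_one hz) (z (Fin.last 1))
  rw [Fin.snoc_init_self] at h
  exact h

/-- The fibre derivative `(1−p)(1+px²)/(1−px²)²` of the tangent-addition chart. -/
def deriv (z : Fin 2 → ℝ) : ℝ :=
  (1 - τ.a₁ (z 0) * τ.a₂ (z 0)) * (1 + τ.a₁ (z 0) * τ.a₂ (z 0) * z 1 ^ 2) /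
    (1 - τ.a₁ (z 0) * τ.a₂ (z 0) * z 1 ^ 2) ^ 2

/-- `deriv_pos`: auxiliary theorem of the arctan-fibre calculus for `RationalCubePiKernelSingle` (stmt-26322) — see the module docstring; verbatim from the lens file. -/
theorem deriv_pos {z : Fin 2 → ℝ} (hz : z ∈ KZ.cube 2) : 0 < τ.deriv z := by
  obtain ⟨-, -, hp1, hp2, hx0, hx1, hD⟩ := τ.facts hz
  unfold deriv
  have hxx : z 1 ^ 2 ≤ 1 := by nlinarith
  have hN : 0 < 1 + τ.a₁ (z 0) * τ.a₂ (z 0) * z 1 ^ 2 := by nlinarith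
  exact div_pos (mul_pos (by linarith) hN) (pow_pos hD 2)

/-- `chart_mem`: auxiliary theorem of the arctan-fibre calculus for `RationalCubePiKernelSingle` (stmt-26322) — see the module docstring; verbatim from the lens file. -/
theorem chart_mem {z : Fin 2 → ℝ} (hz : z ∈ KZ.cube 2) : 0 ≤ τ.chart.fn z ∧ τ.chart.fn z ≤ 1 := by
  obtain ⟨-, -, hp1, hp2, hx0, hx1, hD⟩ := τ.facts hz
  rw [τ.chart_fn hz]
  refine ⟨div_nonneg (mul_nonneg hx0 (by linarith)) hD.le, (div_le_one hD).mpr ?_⟩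
  have : 0 ≤ (1 - z 1) * (1 + τ.a₁ (z 0) * τ.a₂ (z 0) * z 1) :=
    mul_nonneg (by linarith) (by nlinarith)
  nlinarith

/-- `chart_hasDerivAt`: auxiliary theorem of the arctan-fibre calculus for `RationalCubePiKernelSingle` (stmt-26322) — see the module docstring; verbatim from the lens file. -/
theorem chart_hasDerivAt {z : Fin 2 → ℝ} (hz : z ∈ KZ.cube 2) :
    HasDerivAt (fun s : ℝ => τ.chart.fn (Fin.snoc (Fin.init z) s)) (τ.deriv z) (z 1) := by
  obtain ⟨-, -, -, -, -, -, hD⟩ := τ.facts hz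
  have hy := init_mem_cube_one hz
  have hfun : (fun s : ℝ => τ.chart.fn (Fin.snoc (Fin.init z) s)) = fun s =>
      s * (1 - τ.a₁ (z 0) * τ.a₂ (z 0)) / (1 - τ.a₁ (z 0) * τ.a₂ (z 0) * s ^ 2) := by
    funext s
    rw [τ.chart_fn_snoc hy, init_apply_zero]
  rw [hfun]
  have h := ((hasDerivAt_id (z 1)).mul_const (1 - τ.a₁ (z 0) * τ.a₂ (z 0))).div
    (((hasDerivAt_pow 2 (z 1)).const_mul (τ.a₁ (z 0) * τ.a₂ (z 0))).const_sub 1) hD.ne'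
  refine h.congr_deriv ?_
  unfold deriv
  simp only [id, one_mul]
  rw [div_eq_div_iff (pow_ne_zero 2 hD.ne') (pow_ne_zero 2 hD.ne')]
  ring

/-- **Tangent addition.**  For slopes `a₁, a₂ : RFun 1` with `|a₁a₂| < 1` on `[0,1]`, a weight
`w : ℝ → ℝ`, and `T₁ = [w a₁/(1+a₁²x²)]`, `T₂ = [w a₂/(1+a₂²x²)]` (fibre integrals `w·arctan aᵢ`),
`T₃ = [w (a₁+a₂)(1−p)/((1−p)² + (a₁+a₂)²x²)]` (fibre integral `w·arctan((a₁+a₂)/(1−a₁a₂))`):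
`[T₁] + [T₂] ≡ [T₃]` — integrand additivity and ONE fibred change of variables. -/
theorem tan_add (w : ℝ → ℝ) (T₁ T₂ T₃ : RFun 2)
    (hT₁ : ∀ z ∈ KZ.cube 2, T₁.fn z = w (z 0) * τ.a₁ (z 0) / (1 + (τ.a₁ (z 0) * z 1) ^ 2))
    (hT₂ : ∀ z ∈ KZ.cube 2, T₂.fn z = w (z 0) * τ.a₂ (z 0) / (1 + (τ.a₂ (z 0) * z 1) ^ 2))
    (hT₃ : ∀ z ∈ KZ.cube 2, T₃.fn z =
      w (z 0) * (τ.a₁ (z 0) + τ.a₂ (z 0)) * (1 - τ.a₁ (z 0) * τ.a₂ (z 0)) /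
        ((1 - τ.a₁ (z 0) * τ.a₂ (z 0)) ^ 2 + ((τ.a₁ (z 0) + τ.a₂ (z 0)) * z 1) ^ 2)) :
    KZ.of T₁.rep + KZ.of T₂.rep - KZ.of T₃.rep ∈ KZ.relations := by
  have hadd := rel_add T₁ T₂
  have hfib : KZ.of (T₁.add T₂).rep - KZ.of T₃.rep ∈ KZ.relations := by
    refine rel_fibreMap _ _ τ.chart τ.deriv (fun z hz => τ.chart_hasDerivAt hz)
      (fun z hz => τ.deriv_pos hz) (fun x hx => ?_) (fun x hx => ?_) (fun z hz => ?_)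
    · rw [τ.chart_fn_snoc hx]; simp
    · have h := (τ.hp _ (mem_cube_one_iff.mp hx))
      rw [τ.chart_fn_snoc hx, one_pow, mul_one, one_mul]
      exact div_self (by unfold a₁ a₂; linarith)
    · obtain ⟨-, -, hp1, hp2, hx0, hx1, hD⟩ := τ.facts hz
      have hU := τ.chart_mem hz
      have hw : (Fin.snoc (Fin.init z) (τ.chart.fn z) : Fin 2 → ℝ) ∈ KZ.cube 2 :=
        KZ.snoc_mem_cube_iff.2 ⟨init_mem_cube_one hz, hU.1, hU.2⟩
      rw [fn_add hz, hT₁ z hz, hT₂ z hz, hT₃ _ hw, snoc_two_zero, snoc_two_one, init_apply_zero,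
        τ.chart_fn hz, deriv]
      exact tan_identity _ _ _ _ hp1 hp2 hx0 hx1
  have := sub_mem hfib hadd
  convert this using 1
  abel

end TanData

/-! ## 4. Serret's involution of the base `y ↦ (1−y)/(1+y)` -/

end Summit.KontsevichZagierPeriods.RootDecompRationalCubeDichotomy.ArctanFibre

end
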